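import Mathlib
import HarnessLib
import Literature.Analysis.FluidPDE.TsaiMaximumPrinciple
import Summits.NavierStokesRegularity.NavierStokesRegularity.Theorems.PoloidalWindowDoorPoloidalWindowRigidityLocalStrongMaxPrinciple

/-!
# Route `LocalPressureProfileDoor`, crux K2⁺ `MonotonePressureProfileRigidity` (stmt-NavierStokesRegularity-20180), line `birth` —
# kernel tool for the BC5 rung `stub_rung_dssSteadyPressure`: a Liouville theorem for TIME-PERIODIC bounded sub-solutions of
# Ornstein–Uhlenbeck-type drift–diffusion inequalities

Cell ns-regularity-ideate, seat ns-pressure-K2-p1 (LEAD on the crux; file lands `--supports stmt-NavierStokesRegularity-20180`).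

**Statement (`periodic_subsolution_const`).**  On `ℝ × ℝ³` let `Θ(s, y)` be jointly continuous, with `C²` slices and a classical time
derivative `Θt`, `T`-PERIODIC in `s` and BOUNDED, and a classical sub-solution of `∂ₛΘ + DΘ[U + a y] − ΔΘ ≤ 0` for a drift `U(s, y) + a y`
with `‖U(s, y)‖ ≤ M + b‖y‖`, `0 ≤ b < a` (the similarity-variables operator `L = −Δ + (U + ½y)·∇` of Tsai 1998 / Pineau–Vicol 2026 is
`a = ½`, `b = 0`).  Then `Θ` is constant; hence (`periodic_dissipation_eq_zero`) a nonnegative dissipation `D` in the law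
`∂ₛΘ + DΘ[U + a y] − ΔΘ ≤ −D` vanishes identically.

**Proof.**  (1) `exists_forall_le` — the supremum is ATTAINED above every point: the Gaussian penalisation of the tree's elliptic
lemma `Literature.Analysis.FluidPDE.isConst_of_driftOp_nonneg` (Tsai 1998 Lemma 5.1 in Lemarié-Rieusset's form, `TsaiMaximumPrinciple`)
run with `y`-only Gaussians `φ = e^{−β|y−X₀|²}`, `ψ = e^{κ₁|y−X₀|²}` and constants uniform in `s`; periodicity makes every time an
interior time, so at a space–time maximum of `V = Θ + α(φ − γψ)` one has `∂ₛV = 0`, `∇V = 0`, `ΔV ≤ 0`, against `LV ≥ α(Lφ − γLψ) > 0`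
off the thin cylinder where `Θ` stays below its line maximum (uniform continuity over a period); the outward drift `a y·∇` is what lets
a BOUNDED function be penalised by the growing Gaussian `ψ` (Tsai's (1.11)–(1.12)).  (2) The tree's LOCAL PARABOLIC STRONG MAXIMUM PRINCIPLE
`…LocalStrongMaxPrinciple.strongMaximumPrinciple_local` (Lieberman 1996 Ch. II Thm. 2.7) on a unit cylinder below the maximum point, moved
above any given time by periodicity, spreads the maximum to every point.

WHAT THIS IS NOT: not a claim about Navier–Stokes — a linear parabolic lemma (bears_on LADDER-NS N0, route LocalPressureProfileDoor, crux
K2⁺; consumed by the companion file `…RungDssSteadyPressure`).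
-/

noncomputable section

-- the summit and its single sub-problem share the name (CONVENTIONS §1), as in every Theorems file
set_option linter.dupNamespace false

namespace Summit.NavierStokesRegularity.NavierStokesRegularity.Theorems.LocalPressureProfileDoorMonotonePressureProfileRigidityPeriodicLiouville

open Set Function Filter Topology Metric InnerProductSpace
open scoped RealInnerProductSpace Laplacian ContDiff
open Literature.Analysis.FluidPDE
open Summit.NavierStokesRegularity.NavierStokesRegularity.Theorems.PoloidalWindowDoorPoloidalWindowRigidityLocalStrongMaxPrinciple

variable {Θ Θt : ℝ → EuclideanSpace ℝ (Fin 3) → ℝ} {U : ℝ → EuclideanSpace ℝ (Fin 3) → EuclideanSpace ℝ (Fin 3)}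
  {a b M C T : ℝ}

/-! ### A periodic continuous function attains its maximum on every vertical line -/

/-- On a vertical line `ℝ × {X₀}` a jointly continuous, `T`-periodic `Θ` attains its maximum. [folklore] -/
theorem exists_line_max (hT : 0 < T) (hper : Function.Periodic Θ T) (hcont : Continuous (uncurry Θ))
    (X₀ : EuclideanSpace ℝ (Fin 3)) : ∃ s₀, ∀ s, Θ s X₀ ≤ Θ s₀ X₀ := by
  have hc : Continuous fun s : ℝ => Θ s X₀ := hcont.comp (continuous_id.prodMk continuous_const)
  obtain ⟨s₀, -, hs₀⟩ := (isCompact_Icc (a := (0 : ℝ)) (b := T)).exists_isMaxOn (nonempty_Icc.2 hT.le) hc.continuousOn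
  refine ⟨s₀, fun s => ?_⟩
  obtain ⟨s', hs', he⟩ := hper.exists_mem_Ico₀ hT s
  rw [show Θ s X₀ = Θ s' X₀ from congrFun he X₀]
  exact hs₀ (Ico_subset_Icc_self hs')

/-- Uniform continuity over one period: for a jointly continuous `T`-periodic `Θ`, every `X₀` and `ε > 0` admit `R₀ ∈ (0, 1)` with
`Θ(s, y) ≤ Θ(s, X₀) + ε` for ALL `s` and `‖y − X₀‖ ≤ R₀`. [folklore] -/
theorem exists_radius_le_add (hT : 0 < T) (hper : Function.Periodic Θ T) (hcont : Continuous (uncurry Θ))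
    (X₀ : EuclideanSpace ℝ (Fin 3)) {ε : ℝ} (hε : 0 < ε) :
    ∃ R₀ : ℝ, 0 < R₀ ∧ R₀ < 1 ∧ ∀ s y, ‖y - X₀‖ ≤ R₀ → Θ s y ≤ Θ s X₀ + ε := by
  set K : Set (ℝ × EuclideanSpace ℝ (Fin 3)) := Icc 0 T ×ˢ closedBall X₀ 1 with hK
  have hKc : IsCompact K := isCompact_Icc.prod (isCompact_closedBall _ _)
  have huc : UniformContinuousOn (uncurry Θ) K := hKc.uniformContinuousOn_of_continuous hcont.continuousOn
  obtain ⟨η, hη0, hη⟩ := Metric.uniformContinuousOn_iff.1 huc ε hε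
  refine ⟨min (η / 2) (1 / 2), lt_min (half_pos hη0) one_half_pos, (min_le_right _ _).trans_lt (by norm_num),
    fun s y hy => ?_⟩
  obtain ⟨s', hs', he⟩ := hper.exists_mem_Ico₀ hT s
  rw [show Θ s y = Θ s' y from congrFun he y, show Θ s X₀ = Θ s' X₀ from congrFun he X₀]
  have hy1 : ‖y - X₀‖ ≤ 1 := hy.trans ((min_le_right _ _).trans (by norm_num))
  have hmem1 : (s', y) ∈ K := ⟨Ico_subset_Icc_self hs', by rwa [mem_closedBall, dist_eq_norm]⟩
  have hmem2 : (s', X₀) ∈ K := ⟨Ico_subset_Icc_self hs', mem_closedBall_self zero_le_one⟩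
  have hd : dist (s', y) (s', X₀) < η := by
    rw [Prod.dist_eq, dist_self, dist_eq_norm, max_eq_right (norm_nonneg _)]
    exact (hy.trans (min_le_left _ _)).trans_lt (half_lt_self hη0)
  have h := hη _ hmem1 _ hmem2 hd
  rw [Real.dist_eq] at h
  simp only [uncurry_apply_pair] at h
  linarith [(abs_lt.1 h).2]

/-! ### Step 1: the supremum is attained on every vertical line (periodic Gaussian penalisation) -/

/-- A jointly continuous `W`, `T`-periodic in `s`, which outside the cylinder over `B̄(X₀, R₂)` stays below its value at a point of
that cylinder, attains a global maximum (compactness of `[0, T] × B̄(X₀, R₂)`). [folklore] -/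
theorem exists_forall_le_of_periodic_of_le_outside {W : ℝ → EuclideanSpace ℝ (Fin 3) → ℝ} (hT : 0 < T)
    (hWper : ∀ s y, W (s + T) y = W s y) (hWc : Continuous (uncurry W)) {X₀ X₁ : EuclideanSpace ℝ (Fin 3)}
    {s₁ R₂ : ℝ} (hX₁ : ‖X₁ - X₀‖ ≤ R₂) (hfar : ∀ s y, R₂ ≤ ‖y - X₀‖ → W s y ≤ W s₁ X₁) :
    ∃ s₂ X₂, ∀ s y, W s y ≤ W s₂ X₂ := by
  have hper : Function.Periodic W T := fun s => funext fun y => hWper s y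
  set K₂ : Set (ℝ × EuclideanSpace ℝ (Fin 3)) := Icc 0 T ×ˢ closedBall X₀ R₂ with hK₂
  have hK₂c : IsCompact K₂ := isCompact_Icc.prod (isCompact_closedBall _ _)
  obtain ⟨t₁, ht₁, he₁⟩ := hper.exists_mem_Ico₀ hT s₁
  have hmem₁ : (t₁, X₁) ∈ K₂ := ⟨Ico_subset_Icc_self ht₁, by rwa [mem_closedBall, dist_eq_norm]⟩
  obtain ⟨p, -, hp⟩ := hK₂c.exists_isMaxOn ⟨_, hmem₁⟩ hWc.continuousOn
  refine ⟨p.1, p.2, fun s y => ?_⟩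
  obtain ⟨s', hs', he⟩ := hper.exists_mem_Ico₀ hT s
  rw [show W s y = W s' y from congrFun he y]
  rcases le_or_gt ‖y - X₀‖ R₂ with h | h
  · exact hp (show (s', y) ∈ K₂ from ⟨Ico_subset_Icc_self hs', by rwa [mem_closedBall, dist_eq_norm]⟩)
  · have h1 : W s' y ≤ W s₁ X₁ := hfar s' y h.le
    rw [show W s₁ X₁ = W t₁ X₁ from congrFun he₁ X₁] at h1
    exact h1.trans (hp hmem₁)

/-- The barrier `φ = e^{−β|y−X₀|²}`, uniformly in `s`: for `‖U(s,y)‖ ≤ M + b‖y‖`, `0 ≤ b ≤ a`, and `R₀ > 0` there is `β > 0` with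
`Lφ ≥ βφ` off `B(X₀, R₀)` for every slice operator `L = driftOp 1 a (U s)`. [cite: LemarieRieusset2016, Lemma 16.8 (proof)] -/
theorem exists_barrier_rate (hb : 0 ≤ b) (hba : b ≤ a) (hU : ∀ s y, ‖U s y‖ ≤ M + b * ‖y‖)
    (X₀ : EuclideanSpace ℝ (Fin 3)) {R₀ : ℝ} (hR₀ : 0 < R₀) :
    ∃ β : ℝ, 0 < β ∧ ∀ s y, R₀ ≤ ‖y - X₀‖ →
      β * gaussAt (-β) X₀ y ≤ driftOp 1 a (U s) (gaussAt (-β) X₀) y := by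
  have hM : 0 ≤ M := (norm_nonneg _).trans ((hU 0 0).trans_eq (by rw [norm_zero, mul_zero, add_zero]))
  have ha : 0 ≤ a := hb.trans hba
  set d : ℝ := (Module.finrank ℝ (EuclideanSpace ℝ (Fin 3)) : ℝ) with hd
  have hd0 : (0 : ℝ) ≤ d := Nat.cast_nonneg _
  obtain ⟨M₁, hM₁0, hM₁⟩ : ∃ M₁ : ℝ, 0 ≤ M₁ ∧ M₁ = M + (a + b) * ‖X₀‖ := ⟨_, by positivity, rfl⟩
  obtain ⟨β, hβ0, hβeq⟩ : ∃ β : ℝ, 0 < β ∧ 4 * 1 * β * R₀ ^ 2 = 2 * M₁ * R₀ + 2 * d * 1 + 1 := by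
    refine ⟨(2 * M₁ * R₀ + 2 * d * 1 + 1) / (4 * 1 * R₀ ^ 2), by positivity, ?_⟩
    field_simp
  refine ⟨β, hβ0, fun s y hy => ?_⟩
  have h1 := driftOp_gaussAt_neg_lower (ν := 1) hb hba hβ0.le (hU s) X₀ y
  have hq := one_le_barrier_quad zero_le_one hM₁0 hd0 hR₀ hβeq hy
  rw [← hM₁] at h1
  refine le_trans ?_ h1
  have h0 : 0 ≤ β * gaussAt (-β) X₀ y := mul_nonneg hβ0.le (gaussAt_pos _ _ _).le
  have := mul_le_mul_of_nonneg_left hq h0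
  linarith

/-- The penalisation `ψ = e^{κ₁|y−X₀|²}`, uniformly in `s`: for `0 ≤ b < a`, `‖U(s,y)‖ ≤ M + b‖y‖` there are `κ₁ > 0`, `R₁ ≥ max 1 R`
and `K ≥ 0` with `Lψ ≤ −κ₁ψ` off `B(X₀, R₁)` and `|Lψ| ≤ K` on `B̄(X₀, R₁)` for every `L = driftOp 1 a (U s)` (Tsai's (1.11)–(1.12): `y·∇`
magnifies at Gaussian rate). [cite: Tsai1998, (1.11)–(1.12); LemarieRieusset2016, Lemma 16.8 (proof)] -/
theorem exists_penalisation_rate (hb : 0 ≤ b) (hba : b < a) (hU : ∀ s y, ‖U s y‖ ≤ M + b * ‖y‖)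
    (X₀ : EuclideanSpace ℝ (Fin 3)) (R : ℝ) :
    ∃ κ₁ R₁ K : ℝ, 0 < κ₁ ∧ R ≤ R₁ ∧ 1 ≤ R₁ ∧ 0 ≤ K ∧
      (∀ s y, R₁ ≤ ‖y - X₀‖ → driftOp 1 a (U s) (gaussAt κ₁ X₀) y ≤ -(κ₁ * gaussAt κ₁ X₀ y)) ∧
      (∀ s y, ‖y - X₀‖ ≤ R₁ → |driftOp 1 a (U s) (gaussAt κ₁ X₀) y| ≤ K) := by
  have hM : 0 ≤ M := (norm_nonneg _).trans ((hU 0 0).trans_eq (by rw [norm_zero, mul_zero, add_zero]))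
  have ha : 0 ≤ a := hb.trans hba.le
  have hab : 0 < a - b := sub_pos.2 hba
  set d : ℝ := (Module.finrank ℝ (EuclideanSpace ℝ (Fin 3)) : ℝ) with hd
  have hd0 : (0 : ℝ) ≤ d := Nat.cast_nonneg _
  obtain ⟨M₁, hM₁0, hM₁⟩ : ∃ M₁ : ℝ, 0 ≤ M₁ ∧ M₁ = M + (a + b) * ‖X₀‖ := ⟨_, by positivity, rfl⟩
  obtain ⟨κ₁, hκ₁0, hκ₁lt⟩ : ∃ κ₁ : ℝ, 0 < κ₁ ∧ 4 * κ₁ < a - b :=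
    ⟨(a - b) / 8, by positivity, by linarith⟩
  obtain ⟨B, hB0, hB⟩ : ∃ B : ℝ, 0 < B ∧ B = 2 * (a - b) - 4 * 1 * κ₁ := ⟨_, by linarith, rfl⟩
  obtain ⟨R₁, hR₁1, hR₁s, hR₁B⟩ : ∃ R₁ : ℝ, 1 ≤ R₁ ∧ R ≤ R₁ ∧ (2 * M₁ + 2 * d * 1 + 1) / B ≤ R₁ :=
    ⟨max (max 1 R) ((2 * M₁ + 2 * d * 1 + 1) / B), (le_max_left _ _).trans (le_max_left _ _),
      (le_max_right _ _).trans (le_max_left _ _), le_max_right _ _⟩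
  obtain ⟨K, hK0, hK⟩ : ∃ K : ℝ, 0 ≤ K ∧ K = κ₁ * Real.exp (κ₁ * R₁ ^ 2) *
      (4 * 1 * κ₁ * R₁ ^ 2 + 2 * d * 1 + 2 * (M₁ + (a + b) * R₁) * R₁) := ⟨_, by positivity, rfl⟩
  refine ⟨κ₁, R₁, K, hκ₁0, hR₁s, hR₁1, hK0, fun s y hy => ?_, fun s y hy => ?_⟩
  · have h1 := driftOp_gaussAt_upper (ν := 1) hb hba.le hκ₁0.le (hU s) X₀ y
    rw [← hM₁, ← hB] at h1
    have hBr : 2 * M₁ + 2 * d * 1 + 1 ≤ B * ‖y - X₀‖ := by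
      have h2 : (2 * M₁ + 2 * d * 1 + 1) / B ≤ ‖y - X₀‖ := hR₁B.trans hy
      rw [div_le_iff₀ hB0] at h2
      linarith
    have hq := one_le_penal_quad zero_le_one hd0 (hR₁1.trans hy) hBr
    refine h1.trans ?_
    have h0 : 0 ≤ κ₁ * gaussAt κ₁ X₀ y := mul_nonneg hκ₁0.le (gaussAt_pos _ _ _).le
    have := mul_le_mul_of_nonneg_left hq h0
    linarith
  · have h1 := abs_driftOp_gaussAt_le zero_le_one hb hba.le hκ₁0.le (hU s) X₀ y
    rw [← hM₁] at h1
    refine h1.trans ?_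
    rw [hK]
    have hr0 : 0 ≤ ‖y - X₀‖ := norm_nonneg _
    gcongr
    exact gaussAt_mono_radius hκ₁0.le _ hy

/-- **The maximum over a vertical line is a global maximum.**  For `Θ : ℝ × ℝ³ → ℝ` jointly continuous, with `C²` slices and a classical
time derivative `Θt`, `T`-periodic in `s`, bounded, and a classical sub-solution `Θt ≤ ΔΘ − DΘ[U + a y]` (`= driftOp 1 a (U s) (Θ s)`),
`‖U(s,y)‖ ≤ M + b‖y‖`, `0 ≤ b < a`: for every `X₀` there is `s₀` with `Θ(s, y) ≤ Θ(s₀, X₀)` for ALL `(s, y)` (periodic Gaussian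
penalisation `V = Θ + α(e^{−β|y−X₀|²} − γ e^{κ₁|y−X₀|²})`, every time being interior). [cite: LemarieRieusset2016, Lemma 16.8; Tsai1998, Lemma 5.1] -/
theorem exists_forall_le (hT : 0 < T) (hper : Function.Periodic Θ T) (hcont : Continuous (uncurry Θ))
    (hΘ2 : ∀ s, ContDiff ℝ 2 (Θ s)) (hΘt : ∀ y s, HasDerivAt (fun σ => Θ σ y) (Θt s y) s)
    (hb : 0 ≤ b) (hba : b < a) (hU : ∀ s y, ‖U s y‖ ≤ M + b * ‖y‖) (hbdd : ∀ s y, |Θ s y| ≤ C)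
    (hsub : ∀ s y, Θt s y ≤ driftOp 1 a (U s) (Θ s) y) (X₀ : EuclideanSpace ℝ (Fin 3)) :
    ∃ s₀, ∀ s y, Θ s y ≤ Θ s₀ X₀ := by
  obtain ⟨s₀, hs₀⟩ := exists_line_max hT hper hcont X₀
  refine ⟨s₀, fun s₁ X₁ => ?_⟩
  by_contra hlt
  push Not at hlt
  have hC : 0 ≤ C := (abs_nonneg _).trans (hbdd 0 0)
  obtain ⟨δ, hδ0, hδ⟩ : ∃ δ : ℝ, 0 < δ ∧ Θ s₁ X₁ = Θ s₀ X₀ + δ :=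
    ⟨Θ s₁ X₁ - Θ s₀ X₀, sub_pos.2 hlt, by ring⟩
  -- `R₀`: a thin cylinder about the line through `X₀` on which `Θ ≤ Θ s₀ X₀ + δ/4`
  obtain ⟨R₀, hR₀0, -, hR₀Θ'⟩ := exists_radius_le_add hT hper hcont X₀ (by positivity : 0 < δ / 4)
  have hR₀Θ : ∀ s y, ‖y - X₀‖ ≤ R₀ → Θ s y ≤ Θ s₀ X₀ + δ / 4 := fun s y hy =>
    (hR₀Θ' s y hy).trans (by linarith [hs₀ s])
  have hX₁far : R₀ < ‖X₁ - X₀‖ := by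
    by_contra h
    push Not at h
    have := hR₀Θ s₁ X₁ h
    linarith
  -- the barrier `φ = exp(-β |y - X₀|²)` and the penalisation `ψ = exp(κ₁ |y - X₀|²)`
  obtain ⟨β, hβ0, hφL'⟩ := exists_barrier_rate hb hba.le hU X₀ hR₀0
  obtain ⟨φ, hφ⟩ : ∃ φ : EuclideanSpace ℝ (Fin 3) → ℝ, φ = gaussAt (-β) X₀ := ⟨_, rfl⟩
  have hφ2 : ContDiff ℝ 2 φ := hφ ▸ contDiff_gaussAt _ _
  have hφle1 : ∀ y, φ y ≤ 1 := fun y => hφ ▸ gaussAt_le_one_of_nonpos (by linarith) _ _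
  have hφpos : ∀ y, 0 < φ y := fun y => hφ ▸ gaussAt_pos _ _ _
  have hφL : ∀ s y, R₀ ≤ ‖y - X₀‖ → β * φ y ≤ driftOp 1 a (U s) φ y := fun s y hy => by
    rw [hφ]; exact hφL' s y hy
  obtain ⟨κ₁, R₁, K, hκ₁0, hR₁s, hR₁1, hK0, hψL_far', hψL_near'⟩ :=
    exists_penalisation_rate hb hba hU X₀ (‖X₁ - X₀‖ + 1)
  have hR₀R₁ : R₀ < R₁ := by linarith [norm_nonneg (X₁ - X₀)]
  have hs₁R₁ : ‖X₁ - X₀‖ ≤ R₁ := by linarith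
  obtain ⟨ψ, hψ⟩ : ∃ ψ : EuclideanSpace ℝ (Fin 3) → ℝ, ψ = gaussAt κ₁ X₀ := ⟨_, rfl⟩
  have hψ2 : ContDiff ℝ 2 ψ := hψ ▸ contDiff_gaussAt _ _
  have hψpos : ∀ y, 0 < ψ y := fun y => hψ ▸ gaussAt_pos _ _ _
  have hψle : ∀ y, ‖y - X₀‖ ≤ R₁ → ψ y ≤ Real.exp (κ₁ * R₁ ^ 2) := fun y hy =>
    hψ ▸ gaussAt_mono_radius hκ₁0.le _ hy
  have hψeq : ∀ y, ψ y = Real.exp (κ₁ * ‖y - X₀‖ ^ 2) := fun y => by rw [hψ]; rfl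
  have hψL_far : ∀ s y, R₁ ≤ ‖y - X₀‖ → driftOp 1 a (U s) ψ y ≤ -(κ₁ * ψ y) := fun s y hy => by
    rw [hψ]; exact hψL_far' s y hy
  have hψL_near : ∀ s y, ‖y - X₀‖ ≤ R₁ → |driftOp 1 a (U s) ψ y| ≤ K := fun s y hy => by
    rw [hψ]; exact hψL_near' s y hy
  -- the constants `γ`, `α` and the auxiliary function `V = Θ + α (φ - γ ψ)`
  obtain ⟨Φm, hΦm0, hφL_mid⟩ : ∃ Φm : ℝ, 0 < Φm ∧
      ∀ s y, R₀ ≤ ‖y - X₀‖ → ‖y - X₀‖ ≤ R₁ → Φm ≤ driftOp 1 a (U s) φ y := by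
    refine ⟨β * Real.exp (-β * R₁ ^ 2), by positivity, fun s y hy hy' => ?_⟩
    refine le_trans ?_ (hφL s y hy)
    rw [hφ]
    exact mul_le_mul_of_nonneg_left (gaussAt_anti_radius (by linarith) X₀ hy') hβ0.le
  obtain ⟨γ, hγ0, hγK⟩ : ∃ γ : ℝ, 0 < γ ∧ γ * K < Φm := by
    refine ⟨Φm / (2 * (K + 1)), by positivity, ?_⟩
    rw [div_mul_eq_mul_div, div_lt_iff₀ (by positivity)]
    nlinarith
  obtain ⟨S, hS0, hS⟩ : ∃ S : ℝ, 0 < S ∧ S = 1 + γ * Real.exp (κ₁ * R₁ ^ 2) :=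
    ⟨_, by positivity, rfl⟩
  have hφψ : ∀ y, ‖y - X₀‖ ≤ R₁ → |φ y - γ * ψ y| ≤ S := by
    intro y hy
    refine (abs_sub _ _).trans ?_
    rw [abs_of_pos (hφpos y), abs_of_pos (mul_pos hγ0 (hψpos y)), hS]
    gcongr
    · exact hφle1 y
    · exact hψle y hy
  obtain ⟨α, hα0, hαS⟩ : ∃ α : ℝ, 0 < α ∧ α * S = δ / 8 :=
    ⟨δ / (8 * S), by positivity, by field_simp⟩
  obtain ⟨V, hV⟩ : ∃ V : ℝ → EuclideanSpace ℝ (Fin 3) → ℝ, V = fun s => Θ s + α • (φ - γ • ψ) := ⟨_, rfl⟩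
  have hVapply : ∀ s y, V s y = Θ s y + α * (φ y - γ * ψ y) := fun s y => by
    simp only [hV, Pi.add_apply, Pi.smul_apply, Pi.sub_apply, smul_eq_mul]
  have hV2 : ∀ s, ContDiff ℝ 2 (V s) := fun s =>
    hV ▸ (hΘ2 s).add (contDiff_const.smul (hφ2.sub (contDiff_const.smul hψ2)))
  have hLV : ∀ s y, driftOp 1 a (U s) (V s) y =
      driftOp 1 a (U s) (Θ s) y + α * (driftOp 1 a (U s) φ y - γ * driftOp 1 a (U s) ψ y) := fun s y => by
    rw [hV]; exact driftOp_add_smul_sub 1 a (U s) (hΘ2 s) hφ2 hψ2 α γ y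
  have hVper : ∀ s y, V (s + T) y = V s y := fun s y => by
    rw [hVapply, hVapply, show Θ (s + T) y = Θ s y from congrFun (hper s) y]
  have hVcont : Continuous (uncurry V) := by
    have e : uncurry V = fun p : ℝ × EuclideanSpace ℝ (Fin 3) => uncurry Θ p + α * (φ p.2 - γ * ψ p.2) := by
      funext p; rcases p with ⟨s, y⟩; simp only [uncurry_apply_pair, hVapply]
    rw [e]
    exact hcont.add (continuous_const.mul ((hφ2.continuous.comp continuous_snd).sub
      (continuous_const.mul (hψ2.continuous.comp continuous_snd))))
  -- `V s₁ X₁` is large, `V` is small on the thin cylinder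
  have hVX₁ : Θ s₀ X₀ + 7 * δ / 8 ≤ V s₁ X₁ := by
    rw [hVapply]
    have h1 := hφψ X₁ hs₁R₁
    have h2 : -S ≤ φ X₁ - γ * ψ X₁ := (neg_le_neg h1).trans (neg_abs_le _)
    have h3 := mul_le_mul_of_nonneg_left h2 hα0.le
    rw [mul_neg, hαS] at h3
    linarith
  have hVsmall : ∀ s y, ‖y - X₀‖ ≤ R₀ → V s y < V s₁ X₁ := by
    intro s y hy
    rw [hVapply]
    have h1 := hφψ y (hy.trans hR₀R₁.le)
    have h2 : φ y - γ * ψ y ≤ S := (le_abs_self _).trans h1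
    have h3 := mul_le_mul_of_nonneg_left h2 hα0.le
    rw [hαS] at h3
    have h4 := hR₀Θ s y hy
    linarith
  -- decay at infinity, uniformly in `s`: `V ≤ V s₁ X₁` outside a large ball
  obtain ⟨R₂, hR₁R₂, hVfar⟩ : ∃ R₂ : ℝ, R₁ ≤ R₂ ∧ ∀ s y, R₂ ≤ ‖y - X₀‖ → V s y ≤ V s₁ X₁ := by
    refine ⟨max R₁ ((2 * C + α + δ) / (α * γ * κ₁)), le_max_left _ _, fun s y hy => ?_⟩
    have hr1 : 1 ≤ ‖y - X₀‖ := hR₁1.trans ((le_max_left _ _).trans hy)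
    have hr2 : (2 * C + α + δ) / (α * γ * κ₁) ≤ ‖y - X₀‖ := (le_max_right _ _).trans hy
    have h3 : 2 * C + α + δ ≤ α * γ * κ₁ * ‖y - X₀‖ := by
      rw [div_le_iff₀ (by positivity)] at hr2; linarith
    have h4 : α * γ * κ₁ * ‖y - X₀‖ ≤ α * γ * κ₁ * ‖y - X₀‖ ^ 2 := by
      have : ‖y - X₀‖ ≤ ‖y - X₀‖ ^ 2 := by nlinarith
      exact mul_le_mul_of_nonneg_left this (by positivity)
    have h5 : κ₁ * ‖y - X₀‖ ^ 2 ≤ ψ y := by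
      rw [hψeq]; linarith [Real.add_one_le_exp (κ₁ * ‖y - X₀‖ ^ 2)]
    have h6 : α * γ * (κ₁ * ‖y - X₀‖ ^ 2) ≤ α * γ * ψ y := mul_le_mul_of_nonneg_left h5 (by positivity)
    have h7 : Θ s y ≤ C := (le_abs_self _).trans (hbdd s y)
    have h8 : -C ≤ Θ s₀ X₀ := (neg_le_neg (hbdd s₀ X₀)).trans (neg_abs_le _)
    rw [hVapply]
    have h9 : α * (φ y - γ * ψ y) = α * φ y - α * γ * ψ y := by ring
    have h10 : α * φ y ≤ α * 1 := mul_le_mul_of_nonneg_left (hφle1 y) hα0.le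
    linarith
  -- a global space–time maximum `(s₂, X₂)` of `V` (compactness of one period × a ball)
  obtain ⟨s₂, X₂, hmax⟩ : ∃ s₂ X₂, ∀ s y, V s y ≤ V s₂ X₂ :=
    exists_forall_le_of_periodic_of_le_outside hT hVper hVcont (hs₁R₁.trans hR₁R₂) hVfar
  -- at the maximum: `L V ≤ 0` in space, `Θt = 0` in time (every time is interior), `Θt ≤ LΘ`
  have hLV2 : driftOp 1 a (U s₂) (V s₂) X₂ ≤ 0 :=
    driftOp_nonpos_of_isMax zero_le_one (U s₂) (hV2 s₂) fun y => hmax s₂ y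
  have hΘt0 : Θt s₂ X₂ = 0 := by
    have hloc : IsLocalMax (fun σ => V σ X₂) s₂ := Filter.Eventually.of_forall fun σ => hmax σ X₂
    have hder : HasDerivAt (fun σ => V σ X₂) (Θt s₂ X₂) s₂ := by
      have e : (fun σ => V σ X₂) = fun σ => Θ σ X₂ + α * (φ X₂ - γ * ψ X₂) := funext fun σ => hVapply σ X₂
      rw [e]
      exact (hΘt X₂ s₂).add_const _
    exact hloc.hasDerivAt_eq_zero hder
  rw [hLV] at hLV2
  have hΘ2' : 0 ≤ driftOp 1 a (U s₂) (Θ s₂) X₂ := hΘt0 ▸ hsub s₂ X₂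
  -- case analysis on the position of `X₂`
  rcases le_or_gt ‖X₂ - X₀‖ R₀ with h1 | h1
  · exact absurd (hmax s₁ X₁) (not_le.2 (hVsmall s₂ X₂ h1))
  have hpos : 0 < driftOp 1 a (U s₂) φ X₂ - γ * driftOp 1 a (U s₂) ψ X₂ := by
    rcases le_or_gt ‖X₂ - X₀‖ R₁ with h2 | h2
    · have hφ2' := hφL_mid s₂ X₂ h1.le h2
      have hψ2' := (le_abs_self _).trans (hψL_near s₂ X₂ h2)
      have := mul_le_mul_of_nonneg_left hψ2' hγ0.le
      linarith
    · have hφ2' := hφL s₂ X₂ (hR₀R₁.le.trans h2.le)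
      have hψ2' := hψL_far s₂ X₂ h2.le
      have e1 := mul_pos hβ0 (hφpos X₂)
      have e2 := mul_pos hγ0 (mul_pos hκ₁0 (hψpos X₂))
      have := mul_le_mul_of_nonneg_left hψ2' hγ0.le
      have e3 : γ * -(κ₁ * ψ X₂) = -(γ * (κ₁ * ψ X₂)) := by ring
      linarith
  have := mul_pos hα0 hpos
  linarith

/-! ### Step 2: the strong maximum principle spreads the maximum (Liouville) -/

/-- **Liouville theorem for time-periodic bounded sub-solutions.**  A jointly continuous `Θ : ℝ × ℝ³ → ℝ` with `C²` slices and a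
classical time derivative, `T`-periodic in `s`, bounded, and a classical sub-solution of `∂ₛΘ + DΘ[U + a y] − ΔΘ ≤ 0` with
`‖U(s, y)‖ ≤ M + b‖y‖`, `0 ≤ b < a`, is constant (`exists_forall_le` + the local parabolic strong maximum principle on a unit cylinder
below the maximum time, moved above any given time by periodicity). [cite: Lieberman1996, Ch. II Thm. 2.7; LemarieRieusset2016, Lemma 16.8] -/
theorem periodic_subsolution_const (hT : 0 < T) (hper : Function.Periodic Θ T) (hcont : Continuous (uncurry Θ))
    (hΘ2 : ∀ s, ContDiff ℝ 2 (Θ s)) (hΘt : ∀ y s, HasDerivAt (fun σ => Θ σ y) (Θt s y) s)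
    (hb : 0 ≤ b) (hba : b < a) (hU : ∀ s y, ‖U s y‖ ≤ M + b * ‖y‖) (hbdd : ∀ s y, |Θ s y| ≤ C)
    (hlaw : ∀ s y, Θt s y + fderiv ℝ (Θ s) y (U s y + a • y) - (Δ (Θ s)) y ≤ 0)
    (s s' : ℝ) (y y' : EuclideanSpace ℝ (Fin 3)) : Θ s y = Θ s' y' := by
  have hsub : ∀ s y, Θt s y ≤ driftOp 1 a (U s) (Θ s) y := fun s y => by
    have := hlaw s y; unfold driftOp; linarith
  have ha : 0 < a := hb.trans_lt hba
  have hM : 0 ≤ M := (norm_nonneg _).trans ((hU 0 0).trans_eq (by rw [norm_zero, mul_zero, add_zero]))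
  -- every point carries the maximum value
  have key : ∀ s y, ∀ s' y', Θ s' y' ≤ Θ s y := by
    intro s y
    obtain ⟨s₀, hs₀⟩ := exists_forall_le hT hper hcont hΘ2 hΘt hb hba hU hbdd hsub y
    -- move the maximum time into `(s, s + T]`
    obtain ⟨s₁, hs₁, he₁⟩ := hper.exists_mem_Ioc hT s₀ s
    have hmax₁ : ∀ s' y', Θ s' y' ≤ Θ s₁ y := fun s' y' =>
      (hs₀ s' y').trans (le_of_eq (congrFun he₁ y))
    -- the local strong maximum principle on the unit cylinder about `y` over `[s, s₁]`
    set A : ℝ := M + (a + b) * (‖y‖ + 1) with hA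
    have hbA : ∀ t ∈ Icc s s₁, ∀ x : EuclideanSpace ℝ (Fin 3), ‖x - y‖ ≤ 1 → ‖U t x + a • x‖ ≤ A := by
      intro t _ x hx
      have hxn : ‖x‖ ≤ ‖y‖ + 1 := by
        have := norm_add_le (x - y) y
        rw [sub_add_cancel] at this
        linarith
      calc ‖U t x + a • x‖ ≤ ‖U t x‖ + ‖a • x‖ := norm_add_le _ _
        _ ≤ M + b * ‖x‖ + a * ‖x‖ := by
            rw [norm_smul, Real.norm_of_nonneg ha.le]; linarith [hU t x]
        _ ≤ A := by rw [hA]; nlinarith [norm_nonneg x]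
    have h := strongMaximumPrinciple_local (b := fun t x => U t x + a • x) (A := A) (M := Θ s₁ y)
      (w := Θ) (wt := Θt) (t₀ := s) (T := s₁) (ρ := 1) (x₀ := y) hbA hcont.continuousOn
      (fun t _ => hΘ2 t) (fun x t _ => hΘt x t) (fun t _ x _ => hlaw t x) (fun t _ x _ => hmax₁ t x)
      (ts := s₁) ⟨hs₁.1, le_rfl⟩ (xs := y) (by rw [sub_self, norm_zero]; exact one_pos) rfl
    have hsy : Θ s y = Θ s₁ y := h s ⟨le_rfl, hs₁.1⟩ y (by rw [sub_self, norm_zero]; exact one_pos)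
    intro s' y'
    rw [hsy]
    exact hmax₁ s' y'
  exact le_antisymm (key s' y' s y) (key s y s' y')

/-- **Dissipation bookkeeping.**  In the setting of `periodic_subsolution_const`, a nonnegative dissipation `D` in the law
`∂ₛΘ + DΘ[U + a y] − ΔΘ ≤ −D` vanishes identically (`Θ` is constant, so every term of the operator vanishes). [folklore] -/
theorem periodic_dissipation_eq_zero {D : ℝ → EuclideanSpace ℝ (Fin 3) → ℝ} (hT : 0 < T)
    (hper : Function.Periodic Θ T) (hcont : Continuous (uncurry Θ))
    (hΘ2 : ∀ s, ContDiff ℝ 2 (Θ s)) (hΘt : ∀ y s, HasDerivAt (fun σ => Θ σ y) (Θt s y) s)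
    (hb : 0 ≤ b) (hba : b < a) (hU : ∀ s y, ‖U s y‖ ≤ M + b * ‖y‖) (hbdd : ∀ s y, |Θ s y| ≤ C)
    (hD0 : ∀ s y, 0 ≤ D s y)
    (hlawD : ∀ s y, Θt s y + fderiv ℝ (Θ s) y (U s y + a • y) - (Δ (Θ s)) y ≤ -D s y)
    (s : ℝ) (y : EuclideanSpace ℝ (Fin 3)) : D s y = 0 := by
  have hlaw : ∀ s y, Θt s y + fderiv ℝ (Θ s) y (U s y + a • y) - (Δ (Θ s)) y ≤ 0 := fun s y =>
    (hlawD s y).trans (neg_nonpos.2 (hD0 s y))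
  have hconst := periodic_subsolution_const hT hper hcont hΘ2 hΘt hb hba hU hbdd hlaw
  have hslice : Θ s = fun _ => Θ 0 0 := funext fun x => hconst s 0 x 0
  have hD : fderiv ℝ (Θ s) y = 0 := by rw [hslice]; simp
  have hL : (Δ (Θ s)) y = 0 := by rw [hslice, laplacian_const]; simp
  have h0 : HasDerivAt (fun σ => Θ σ y) 0 s := by
    have e : (fun σ => Θ σ y) = fun _ => Θ 0 0 := funext fun σ => hconst σ 0 y 0
    rw [e]; exact hasDerivAt_const s _
  have hΘt0 : Θt s y = 0 := (hΘt y s).unique h0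
  have h := hlawD s y
  rw [hΘt0, hD, hL] at h
  simp only [zero_apply, add_zero, sub_zero] at h
  linarith [hD0 s y]

end Summit.NavierStokesRegularity.NavierStokesRegularity.Theorems.LocalPressureProfileDoorMonotonePressureProfileRigidityPeriodicLiouville

end
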